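import Literature.NumberTheory.EllipticCurves.RankinSymmSquareTwistComparison
import Literature.NumberTheory.LFunctions.RankinSelbergLocalPositivity
import Mathlib.RingTheory.PowerSeries.Basic
import Mathlib.NumberTheory.LSeries.Dirichlet
import Mathlib.Data.Nat.Choose.Sum
import HarnessLib

/-!
# The explicit pair function `P_{f₁,f₂}(s)` of Hoffstein–Lockhart's Siegel scheme for symmetric
# squares, and its non-negative Dirichlet series (`coeff₃`) — constructed and proved on `GL₂`

Topic `NumberTheory/EllipticCurves`; namespace `Literature.NumberTheory.EllipticCurves.ModularForms`
(sub-namespace `PairSeries` for the generic multiplicative-function framework). Definitions with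
bodies and theorems; NO named fact (D-0026). Filed in support of the named fact
`murty_petersson_newform_lower_bound` (`NewformPeterssonSize`; Murty 1999 §2 (3) ⇐ Hoffstein–Lockhart
1994 Thm. 0.1).

The tree reduces that fact (`murty_petersson_newform_lower_bound_of_pairData_nonCM`,
`NewformPeterssonSizePairReductionProofs`; `…_of_j_zero`, `NewformPeterssonSizeCMReductionProofs`) to an
ABSTRACT pair datum: functions `P i j : ℂ → ℂ` for the non-CM, non-twist-equivalent pairs of elliptic
newforms with (a) holomorphy on `|s − 2| < 3/2`, (b) a bound `‖P i j s‖ ≤ B₂ (N_iN_j)^{κ₂}` on the closed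
disc, (c) **`coeff₃`**: `ζ₁(s) · L_{f_i}(s) L_{f_j}(s) P_{ij}(s) = (s − 1) L(a, s)` on `Re s > 1` for a
NON-NEGATIVE sequence `a` with `a(1) = 1`, and (d) `‖P i j 1‖ ≤ T(δ)(N_iN_j)^δ`. The model is
`P = L(s, Sym² f_i × Sym² f_j)` (Hoffstein–Lockhart §1), and (c) is the positivity of the Dirichlet
coefficients of `L((f_i ⊗ f̄_i) × (f_j ⊗ f̄_j))`. This file CONSTRUCTS `P` from the Fourier coefficients
of `f_i, f_j` alone and PROVES (c) unconditionally, so that the only remaining input about `P` is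
ANALYTIC — the continuation and growth (a), (b), (d) of one explicit Euler product
(`NewformPeterssonSizePairAnalyticReductionProofs`).

## Construction

For `f ∈ S₂(Γ₀(N))` the newform of an elliptic curve and a prime `p ∤ N` let `a = a_p(f) ∈ ℤ`,
`|a| ≤ 2√p` (Hasse), and `η = (a + i√(4p − a²))/(2√p)` (`unitLetter`; `|η| = 1`, `η + η̄ = a/√p`, so
`{η, η̄} = {α/√p, β/√p}` for the roots of `X² − aX + p`). The multiplicative function `n ↦ ‖a_n‖²/n`
(`normSqCoeffDiv f`, `RankinSymmSquareGL2Fields`) has local series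
`S̃_f(p) = ∑_e ‖a_{p^e}‖² p^{−e} X^e` (`normSqLocal`) satisfying

* `S̃_f(p) · (1 − X)(1 − tX + X²) = 1 + X`, `t = a²/p − 2 = η² + η̄²` (`IsNewform0.normSqLocal_mul_cubic`:
  the Hecke recursion `a_{p^{e+2}} = a_p a_{p^{e+1}} − p a_{p^e}` implies the three-term recursion
  `s_{e+3} = (a² − p)s_{e+2} − (a²p − p²)s_{e+1} + p³ s_e` for `s_e = a_{p^e}²`,
  `sq_recurrence_of_recurrence`), hence `S̃_f(p) = (1 + X) G_1 G_{η²} G_{η̄²}`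
  (`IsNewformOf.normSqLocal_eq_of_not_dvd`; `G_c = ∑ cⁿXⁿ = (1 − cX)⁻¹`) — the classical
  `∑ a_{p^e}² X^e = (1 + pX)/((1 − α²X)(1 − pX)(1 − β²X))` (Bump §3.9) in the unitary variable;
* at `p ∣ N`: `S̃_f(p) = G_{‖a_p‖²/p}` (`a_{p^e} = a_p^e`).

Put (`pairLocalQ`) `Q_p = 1` for `p ∣ N₁N₂` and, for `p ∤ N₁N₂`,
`Q_p = G_1² G_{−1}² · G_{η₁²}G_{η̄₁²} · G_{η₂²}G_{η̄₂²} · G_{η₁²η₂²}G_{η₁²η̄₂²}G_{η̄₁²η₂²}G_{η̄₁²η̄₂²}`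
(`pairGoodQ`: twelve geometric series with unitary ratios, i.e.
`Q_p(p^{−s}) = (1 − p^{−s})⁻¹(1 + p^{−s})⁻² L_p(s, Sym² f₁ × Sym² f₂)` with the nine-letter local
Rankin–Selberg factor of the two symmetric squares in the analytic normalisation), let `q`
(`symmSqPairCoeff`) be the multiplicative function with local series `Q_p` (`PairSeries.ofLocal`), and

  `P(s) = symmSqPairL f₁ f₂ s := ζ(s) · L(q, s)`
  `     = ζ(2s)² · ∏_{p ∣ N₁N₂} (1 − p^{−s})(1 + p^{−s})² · L^{(N₁N₂)}(s, Sym² f₁ × Sym² f₂)`  (`Re s > 1`).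

## Results (all proved)

* `normSqLocal_mul_pairGoodQ_eq`: `S̃₁ S̃₂ Q_p = ∏_{16 letters v}(1 − vX)⁻¹` at `p ∤ N₁N₂`, the letters
  being `(1, η₁², 1, η̄₁²) ⊗ (1, η₂², 1, η̄₂²)` (`pairLetters`) — the local factor of
  `L((f₁ ⊗ f̄₁) × (f₂ ⊗ f̄₂)) = ζ L(Sym² f₁) L(Sym² f₂) L(Sym² f₁ × Sym² f₂)`;
* `coeff_satakeSeries_pairLetters_nonneg`: its coefficients are `≥ 0`, the power sums being
  `|1 + η₁^{2r}|² |1 + η₂^{2r}|²` (Newton's identity, `RankinSelbergLocalPositivity`);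
  `coeff_localT_nonneg`: at `p ∣ N₁N₂` the local series `S̃₁S̃₂` is non-negative trivially;
* `symmSqPairA_nonneg`, `symmSqPairA_one`, `LSeriesSummable_symmSqPairA`: the sequence
  `a = r_{f₁} ⍟ r_{f₂} ⍟ q` (`r_f = rankinCoeff f = 𝟙_□ ⍟ (‖a‖²/n)`, the coefficients of
  `ζ(s)L_f(s) = ζ(2s)L(|a|², s+1)`) equals `𝟙_□ ⍟ 𝟙_□ ⍟ b` with `b` multiplicative of local series
  `S̃₁S̃₂Q_p`, hence `a ≥ 0`; `a(1) = 1`; `L(a, s)` and `L(q, s)` converge absolutely for `Re s > 1`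
  (`‖q(p^e)‖ ≤ C(e+12, 12)`, comparison with the divisor function `d_{13} = 1^{⍟13}`,
  `PairSeries.IsMult.LSeriesSummable_of_prime_pow_le`);
* **`riemannZeta₁_mul_symmSqL_mul_symmSqPairL`**, **`symmSqPairL_coeff₃`**:
  `ζ₁(s) L_{f₁}(s) L_{f₂}(s) P(s) = (s − 1) L(a, s)` for `Re s > 1` — the hypothesis `hcoeff₃` of
  `murty_petersson_newform_lower_bound_of_pairData_nonCM` for `P = symmSqPairL`, for EVERY pair of
  elliptic newforms (no CM or twist condition is needed for the positivity).

The framework `PairSeries` (multiplicative `ℕ → ℂ` functions: `IsMult`, `ofLocal`, the local series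
`locPS`, `locPS_convolution`, `IsMult.nonneg_of_prime_pow`, the divisor powers `divPow` with
`divPow_succ_prime_pow = C(e+m, m)` and the summability criterion) is generic.

## References

* J. Hoffstein, P. Lockhart, *Coefficients of Maass forms and the Siegel zero*, Ann. of Math. 140
  (1994), §1 (the functions `L(s, Sym² f × Sym² g)` and the positivity of
  `ζ L(Sym² f)L(Sym² g)L(Sym² f × Sym² g)`). [cite: HoffsteinLockhart1994, Thm. 0.1 and §1]
* D. Bump, *Automorphic Forms and Representations* (1997), §3.9 (`L_S(s, π × π) = L_S(s, π, ∨²)L_S(s, π, ∧²)`;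
  the local identity `∑ a_{p^e}² X^e = (1 + pX)/((1 − α²X)(1 − pX)(1 − β²X))`). [cite: Bump1997, §3.9]
* H. Iwaniec, E. Kowalski, *Analytic Number Theory* (2004), §5.12, remark after Thm. 5.42
  (`Λ_{π×π̃}(p^k) = |λ_π(p^k)|² ≥ 0`). [cite: IwaniecKowalski2004, §5.12 (after Thm. 5.42)]
* R. A. Rankin, *Contributions to the theory of Ramanujan's function `τ(n)` … II*, Proc. Cambridge
  Philos. Soc. 35 (1939) (`∑ |a_n|² n^{−s}`). [cite: Rankin1939, Thm. 3]

## Mathlib / tree search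

Tree: `rankinCoeff`, `sqInd`, `normSqCoeffDiv`, `symmSqL`, `riemannZeta₁_mul_symmSqL_eq_LSeries`,
`LSeriesSummable_rankinCoeff`, `rankinCoeff_one` (`RankinSymmSquareGL2Fields`);
`IsNewformOf.norm_cuspCoeff_prime_pow_sq_le` (Hasse), `TwistEquiv` (`RankinSymmSquareTwistComparison`);
`IsNewform0.re_cuspCoeff_prime_pow_add_two`, `IsNewform0.norm_cuspCoeff_sq`, `IsNewform0.re_cuspCoeff_one`,
`IsNewform0.re_cuspCoeff_mul_of_coprime`, `IsNewform0.cuspCoeff_prime_pow_of_dvd`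
(`NewformPeterssonSizeSymmSquareProofs`); `satakeSeries`, `powerSum`,
`coeff_satakeSeries_nonneg_of_powerSum_nonneg`, `satakeSeries_prod_index` (`RankinSelbergLocalPositivity`);
`geomSeries`, `one_sub_mul_geomSeries`, `norm_coeff_prod_geomSeries_le` (`TuranFirstMainTheorem`).
Mathlib: `LSeries.convolution` (`⍟`), `LSeries_convolution'`, `LSeriesSummable.convolution`,
`ArithmeticFunction.IsMultiplicative.{mul, eq_iff_eq_on_prime_powers, multiplicative_factorization}`,
`Nat.sum_divisors_prime_pow`, `Nat.sum_range_add_choose`, `LSeriesSummable_one_iff`,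
`riemannZeta_eq_inv_sub_mul`, `PowerSeries.coeff_X_pow_mul'`. `lean search 'Sym.*pair|pairL|symmSqPair'`
in `EllipticCurves/`: nothing of this kind (the `Automorphic/partialPairL` of Satake families is the
abstract `GL_n` object, not connected to `CuspForm (Gamma0 N) 2`).
-/

noncomputable section

open scoped Real ComplexConjugate ComplexOrder
open scoped LSeries.notation
open PowerSeries Complex CongruenceSubgroup Finset LSeries ArithmeticFunction
open Literature.Analysis.Complex.PowerSum (geomSeries one_sub_mul_geomSeries
  norm_coeff_prod_geomSeries_le)
open Literature.NumberTheory.LFunctions (satakeSeries powerSum coeff_satakeSeries_nonneg_of_powerSum_nonneg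
  satakeSeries_prod_index coeff_geomSeries constantCoeff_geomSeries constantCoeff_satakeSeries)

namespace Literature.NumberTheory.EllipticCurves.ModularForms

/-! ### The unitary letter `η = (a + i√(4p − a²))/(2√p)` -/

/-- The unitary Satake letter of a real `a` with `a² ≤ 4p`: `η = (a + i√(4p − a²))/(2√p)`, so that
`η + η̄ = a/√p`, `η η̄ = 1` (`α/√p` for the root `α` of `X² − aX + p`). [folklore] -/
def unitLetter (a : ℝ) (p : ℕ) : ℂ :=
  ⟨a / (2 * Real.sqrt p), Real.sqrt (4 * p - a ^ 2) / (2 * Real.sqrt p)⟩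

section UnitLetter

variable {a : ℝ} {p : ℕ}

/-- `|η|² = 1` when `a² ≤ 4p`. [folklore] -/
theorem normSq_unitLetter (hp : 0 < p) (ha : a ^ 2 ≤ 4 * p) : normSq (unitLetter a p) = 1 := by
  have hp' : (0 : ℝ) < p := by exact_mod_cast hp
  have hsp : 0 < Real.sqrt p := Real.sqrt_pos.mpr hp'
  have h4 : Real.sqrt (4 * p - a ^ 2) * Real.sqrt (4 * p - a ^ 2) = 4 * p - a ^ 2 :=
    Real.mul_self_sqrt (by linarith)
  have hpp : Real.sqrt p * Real.sqrt p = p := Real.mul_self_sqrt hp'.le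
  rw [unitLetter, Complex.normSq_mk, div_mul_div_comm, div_mul_div_comm, ← add_div, h4,
    show (2 * Real.sqrt p) * (2 * Real.sqrt p) = 4 * (Real.sqrt p * Real.sqrt p) by ring, hpp,
    div_eq_one_iff_eq (by positivity)]
  ring

/-- `|η| = 1` when `a² ≤ 4p`. [folklore] -/
theorem norm_unitLetter (hp : 0 < p) (ha : a ^ 2 ≤ 4 * p) : ‖unitLetter a p‖ = 1 := by
  rw [← Real.sqrt_sq (norm_nonneg _), ← Complex.normSq_eq_norm_sq, normSq_unitLetter hp ha,
    Real.sqrt_one]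

/-- `η η̄ = 1`. [folklore] -/
theorem unitLetter_mul_conj (hp : 0 < p) (ha : a ^ 2 ≤ 4 * p) :
    unitLetter a p * conj (unitLetter a p) = 1 := by
  rw [Complex.mul_conj, normSq_unitLetter hp ha, Complex.ofReal_one]

/-- `η + η̄ = a/√p`. [folklore] -/
theorem unitLetter_add_conj (a : ℝ) (p : ℕ) :
    unitLetter a p + conj (unitLetter a p) = ((a / Real.sqrt p : ℝ) : ℂ) := by
  apply Complex.ext
  · simp [unitLetter]; ring
  · simp [unitLetter]

/-- `η² + η̄² = a²/p − 2`. [folklore] -/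
theorem unitLetter_sq_add_conj_sq (hp : 0 < p) (ha : a ^ 2 ≤ 4 * p) :
    unitLetter a p ^ 2 + conj (unitLetter a p) ^ 2 = ((a ^ 2 / p - 2 : ℝ) : ℂ) := by
  have hp' : (0 : ℝ) < p := by exact_mod_cast hp
  have h : unitLetter a p ^ 2 + conj (unitLetter a p) ^ 2 =
      (unitLetter a p + conj (unitLetter a p)) ^ 2 - 2 * (unitLetter a p * conj (unitLetter a p)) := by
    ring
  have hsq : (a / Real.sqrt p) ^ 2 = a ^ 2 / p := by rw [div_pow, Real.sq_sqrt hp'.le]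
  rw [h, unitLetter_add_conj, unitLetter_mul_conj hp ha, ← hsq]
  push_cast
  ring

/-- `η² η̄² = 1`. [folklore] -/
theorem unitLetter_sq_mul_conj_sq (hp : 0 < p) (ha : a ^ 2 ≤ 4 * p) :
    unitLetter a p ^ 2 * conj (unitLetter a p) ^ 2 = 1 := by
  rw [← mul_pow, unitLetter_mul_conj hp ha, one_pow]

/-- `|η²| = 1`. [folklore] -/
theorem norm_unitLetter_sq (hp : 0 < p) (ha : a ^ 2 ≤ 4 * p) : ‖unitLetter a p ^ 2‖ = 1 := by
  rw [norm_pow, norm_unitLetter hp ha, one_pow]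

/-- `|η̄²| = 1`. [folklore] -/
theorem norm_conj_unitLetter_sq (hp : 0 < p) (ha : a ^ 2 ≤ 4 * p) :
    ‖conj (unitLetter a p) ^ 2‖ = 1 := by
  rw [norm_pow, Complex.norm_conj, norm_unitLetter hp ha, one_pow]

/-- `(1 − tX + X²) · G_{η²} · G_{η̄²} = 1` with `t = a²/p − 2`: the inverse of the quadratic local
polynomial. [folklore] -/
theorem quadratic_mul_geomSeries (hp : 0 < p) (ha : a ^ 2 ≤ 4 * p) :
    ((1 : PowerSeries ℂ) - C ((a ^ 2 / p - 2 : ℝ) : ℂ) * X + X ^ 2) *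
        (geomSeries (unitLetter a p ^ 2) * geomSeries (conj (unitLetter a p) ^ 2)) = 1 := by
  set η := unitLetter a p
  have hfac : (1 : PowerSeries ℂ) - C ((a ^ 2 / p - 2 : ℝ) : ℂ) * X + X ^ 2 =
      (1 - C (η ^ 2) * X) * (1 - C (conj η ^ 2) * X) := by
    rw [← unitLetter_sq_add_conj_sq hp ha]
    have h1 := unitLetter_sq_mul_conj_sq hp ha
    have : (X : PowerSeries ℂ) ^ 2 = C (η ^ 2 * conj η ^ 2) * X ^ 2 := by rw [h1, map_one, one_mul]
    rw [this, map_add, map_mul]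
    ring
  rw [hfac, mul_mul_mul_comm, one_sub_mul_geomSeries, one_sub_mul_geomSeries, one_mul]

end UnitLetter

/-! ### `(1 − X) G_1 = 1`, `(1 + X) G_{−1} = 1` -/

/-- `(1 − X) G_1 = 1`. [folklore] -/
theorem one_sub_X_mul_geomSeries_one : ((1 : PowerSeries ℂ) - X) * geomSeries 1 = 1 := by
  have := one_sub_mul_geomSeries 1
  rwa [map_one, one_mul] at this

/-- `(1 + X) G_{−1} = 1`. [folklore] -/
theorem one_add_X_mul_geomSeries_neg_one : ((1 : PowerSeries ℂ) + X) * geomSeries (-1) = 1 := by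
  have := one_sub_mul_geomSeries (-1)
  rwa [map_neg, map_one, neg_one_mul, sub_neg_eq_add] at this


section Local

variable {N : ℕ} [NeZero N] {f : CuspForm (Gamma0 N) 2}

/-- **Squares of a two-term recurrence satisfy a three-term recurrence** (any commutative ring):
if `c (e+2) = A c (e+1) − P c e` for all `e`, then `s e = (c e)²` satisfies
`s (e+3) = (A² − P) s (e+2) − (A² P − P²) s (e+1) + P³ s e`. [folklore] -/
theorem sq_recurrence_of_recurrence {R : Type*} [CommRing R] {c : ℕ → R} {A P : R}
    (h : ∀ e, c (e + 2) = A * c (e + 1) - P * c e) (e : ℕ) :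
    c (e + 3) ^ 2 =
      (A ^ 2 - P) * c (e + 2) ^ 2 - (A ^ 2 * P - P ^ 2) * c (e + 1) ^ 2 + P ^ 3 * c e ^ 2 := by
  have h2 := h e
  have h3 : c (e + 3) = A * c (e + 2) - P * c (e + 1) := h (e + 1)
  linear_combination (c (e + 3) + A * c (e + 2) - P * c (e + 1)) * h3 +
    P * (c (e + 2) - A * c (e + 1) - P * c e) * h2

/-- The local series `S̃_f(p) = ∑_e ‖a_{p^e}‖² p^{-e} X^e ∈ ℂ⟦X⟧` of the multiplicative function
`n ↦ ‖a_n‖²/n` (`normSqCoeffDiv f`) at the prime `p`. [folklore] -/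
def normSqLocal (f : CuspForm (Gamma0 N) 2) (p : ℕ) : PowerSeries ℂ :=
  PowerSeries.mk fun e ↦ normSqCoeffDiv f (p ^ e)

omit [NeZero N] in
/-- The coefficients of `S̃_f(p)`: `‖a_{p^e}‖² / p^e`. [folklore] -/
theorem coeff_normSqLocal (f : CuspForm (Gamma0 N) 2) (p e : ℕ) :
    coeff e (normSqLocal f p) = ((‖cuspCoeff f (p ^ e)‖ ^ 2 / (p : ℝ) ^ e : ℝ) : ℂ) := by
  simp [normSqLocal, normSqCoeffDiv, Nat.cast_pow]

/-- The parameter `t_p(f) = ‖a_p‖²/p − 2` (`= α²/p + β²/p` for the Satake roots `α, β`). [folklore] -/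
def symmSqTrace (f : CuspForm (Gamma0 N) 2) (p : ℕ) : ℝ := ‖cuspCoeff f p‖ ^ 2 / p - 2

/-- Expanded form of the cubic `(1 − X)(1 − tX + X²) = 1 − (t+1)X + (t+1)X² − X³`. [folklore] -/
theorem one_sub_X_mul_quadratic (t : ℂ) :
    ((1 : PowerSeries ℂ) - X) * (1 - C t * X + X ^ 2) =
      1 - C (t + 1) * X + C (t + 1) * X ^ 2 - X ^ 3 := by
  simp only [map_add, map_one]
  ring

/-- Coefficients of `S · (1 − κX + κX² − X³)`. [folklore] -/
theorem coeff_mul_cubic (S : PowerSeries ℂ) (κ : ℂ) (n : ℕ) :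
    coeff n (S * (1 - C κ * X + C κ * X ^ 2 - X ^ 3)) =
      coeff n S - κ * (if 1 ≤ n then coeff (n - 1) S else 0) +
        κ * (if 2 ≤ n then coeff (n - 2) S else 0) - (if 3 ≤ n then coeff (n - 3) S else 0) := by
  have : S * (1 - C κ * X + C κ * X ^ 2 - X ^ 3) =
      S - C κ * (X ^ 1 * S) + C κ * (X ^ 2 * S) - X ^ 3 * S := by ring
  rw [this, map_sub, map_add, map_sub, coeff_C_mul, coeff_C_mul, coeff_X_pow_mul', coeff_X_pow_mul',
    coeff_X_pow_mul']

/-- **The local identity at a good prime** (Rankin; Bump §3.9): for a newform `f ∈ S₂(Γ₀(N))` and a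
prime `p ∤ N`, with `t = ‖a_p‖²/p − 2`,
`(∑_e ‖a_{p^e}‖² p^{-e} X^e) · (1 − X)(1 − tX + X²) = 1 + X` in `ℂ⟦X⟧` — i.e.
`∑_e ‖a_{p^e}‖² p^{-e} X^e = (1 + X)/((1 − X)(1 − α²/p X)(1 − β²/p X))`. From the Hecke recursion
`a_{p^{e+2}} = a_p a_{p^{e+1}} − p a_{p^e}` (real coefficients) via the three-term recurrence for
the squares. [cite: Bump1997, §3.9] -/
theorem IsNewform0.normSqLocal_mul_cubic (hf : IsNewform0 f) {p : ℕ} (hp : p.Prime) (hpN : ¬ p ∣ N) :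
    normSqLocal f p * ((1 - X) * (1 - C (symmSqTrace f p : ℂ) * X + X ^ 2)) = 1 + X := by
  -- real coefficients
  set u : ℕ → ℝ := fun e ↦ (cuspCoeff f (p ^ e)).re with hu
  have hc : ∀ e, ‖cuspCoeff f (p ^ e)‖ ^ 2 = u e ^ 2 := fun e ↦ by rw [hf.norm_cuspCoeff_sq]
  have hu0 : u 0 = 1 := by simp only [hu, pow_zero]; exact hf.re_cuspCoeff_one
  have hu1 : ‖cuspCoeff f p‖ ^ 2 = u 1 ^ 2 := by rw [← hc 1, pow_one]
  have hrec : ∀ e, u (e + 2) = u 1 * u (e + 1) - p * u e := fun e ↦ by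
    have h := hf.re_cuspCoeff_prime_pow_add_two hp e
    simp only [if_neg hpN] at h
    simp only [hu, pow_one]
    exact h
  have hu2 : u 2 = u 1 ^ 2 - p := by
    have h := hrec 0
    rw [zero_add, zero_add, hu0, mul_one] at h
    rw [h]; ring
  have hsq : ∀ e, u (e + 3) ^ 2 = (u 1 ^ 2 - p) * u (e + 2) ^ 2 - (u 1 ^ 2 * p - (p : ℝ) ^ 2) *
      u (e + 1) ^ 2 + (p : ℝ) ^ 3 * u e ^ 2 := sq_recurrence_of_recurrence hrec
  have hp0 : (p : ℝ) ≠ 0 := by exact_mod_cast hp.ne_zero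
  have hp0' : (p : ℂ) ≠ 0 := by exact_mod_cast hp.ne_zero
  -- coefficients of `S̃`
  have hS : ∀ e, coeff e (normSqLocal f p) = ((u e ^ 2 / (p : ℝ) ^ e : ℝ) : ℂ) := fun e ↦ by
    rw [coeff_normSqLocal, hc]
  rw [one_sub_X_mul_quadratic]
  set κ : ℂ := (symmSqTrace f p : ℂ) + 1 with hκ
  have hκ' : κ = ((u 1 ^ 2 / p : ℝ) : ℂ) - 1 := by
    simp only [hκ, symmSqTrace, hu1]; push_cast; ring
  ext n
  rw [coeff_mul_cubic, map_add, coeff_one, coeff_X]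
  rcases n with _ | _ | _ | n
  · simp [hS, hu0]
  · simp only [le_refl, if_true, Nat.reduceLeDiff, if_false, Nat.sub_self, hS, hu0,
      one_ne_zero, zero_add]
    rw [hκ']; push_cast; field_simp; ring
  · simp only [Nat.reduceLeDiff, if_true, if_false, hS, hu0, hu2]
    rw [hκ']; push_cast; field_simp; ring
  · simp only [show 1 ≤ n + 3 from by omega, show 2 ≤ n + 3 from by omega, le_add_iff_nonneg_left,
      zero_le, if_true, show n + 3 - 1 = n + 2 from by omega, show n + 3 - 2 = n + 1 from by omega,
      hS, show (n + 3 = 0) = False from by simp,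
      show (n + 3 = 1) = False from by simp, if_false, add_zero]
    rw [hκ', hsq n]
    push_cast
    field_simp
    ring


/-- **Closed form at a good prime**: `S̃_f(p) = (1 + X) · G_1 · G_{η²} · G_{η̄²}` with `η` the
unitary letter of `a_p` (`p ∤ N`, `f` the newform of an elliptic curve, so that `a_p² ≤ 4p`). [folklore] -/
theorem IsNewformOf.normSqLocal_eq_of_not_dvd {W : WeierstrassCurve ℚ} [W.IsElliptic]
    (hf : IsNewformOf W f) {p : ℕ} (hp : p.Prime) (hpN : ¬ p ∣ N) :
    normSqLocal f p = (1 + X) * (geomSeries 1 *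
      (geomSeries (unitLetter (cuspCoeff f p).re p ^ 2) *
        geomSeries (conj (unitLetter (cuspCoeff f p).re p) ^ 2))) := by
  have ha : (cuspCoeff f p).re ^ 2 ≤ 4 * p := by
    have h := hf.norm_cuspCoeff_prime_pow_sq_le hp 1
    rw [pow_one, pow_one, hf.1.norm_cuspCoeff_sq] at h
    norm_num at h
    linarith
  have ht : (symmSqTrace f p : ℂ) = (((cuspCoeff f p).re ^ 2 / p - 2 : ℝ) : ℂ) := by
    rw [symmSqTrace, hf.1.norm_cuspCoeff_sq]
  have K1 := hf.1.normSqLocal_mul_cubic hp hpN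
  rw [ht] at K1
  have hq := quadratic_mul_geomSeries hp.pos ha
  set Φ := (1 : PowerSeries ℂ) - C (((cuspCoeff f p).re ^ 2 / p - 2 : ℝ) : ℂ) * X + X ^ 2
  set GG := geomSeries (unitLetter (cuspCoeff f p).re p ^ 2) *
    geomSeries (conj (unitLetter (cuspCoeff f p).re p) ^ 2)
  calc normSqLocal f p = normSqLocal f p * (((1 - X) * geomSeries 1) * (Φ * GG)) := by
        rw [one_sub_X_mul_geomSeries_one, hq, one_mul, mul_one]
    _ = normSqLocal f p * ((1 - X) * Φ) * (geomSeries 1 * GG) := by ring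
    _ = (1 + X) * (geomSeries 1 * GG) := by rw [K1]

/-- **At a bad prime** `p ∣ N`: `a_{p^e} = a_p^e`, so `S̃_f(p) = G_c` with `c = ‖a_p‖²/p`. [folklore] -/
theorem IsNewform0.normSqLocal_eq_of_dvd (hf : IsNewform0 f) {p : ℕ} (hp : p.Prime) (hpN : p ∣ N) :
    normSqLocal f p = geomSeries ((‖cuspCoeff f p‖ ^ 2 / p : ℝ) : ℂ) := by
  ext e
  rw [coeff_normSqLocal, coeff_geomSeries, hf.cuspCoeff_prime_pow_of_dvd hp hpN e, norm_pow,
    ← pow_mul, mul_comm, pow_mul, ← div_pow]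
  push_cast
  ring

end Local

/-! ### The sixteen-letter alphabet and the local series `Q_p` at a good prime -/

/-- The four letters `(1, η², 1, η̄²)` of `ζ_p · L_p(Sym² f)` (`= L_p(f × f̄)`). [folklore] -/
def symmSqLetters (η : ℂ) : Fin 4 → ℂ
  | 0 => 1
  | 1 => η ^ 2
  | 2 => 1
  | 3 => conj η ^ 2

/-- The sixteen letters of `L_p((f_1 ⊗ f̄_1) × (f_2 ⊗ f̄_2)) = ζ_p L_p(Sym² f₁) L_p(Sym² f₂) L_p(Sym² f₁ × Sym² f₂)`. [folklore] -/
def pairLetters (η₁ η₂ : ℂ) : Fin 4 × Fin 4 → ℂ := fun x ↦ symmSqLetters η₁ x.1 * symmSqLetters η₂ x.2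

/-- **The local series `Q_p` at a prime good for both forms**: the twelve-letter product
`G_1² G_{−1}² · G_{η₁²}G_{η̄₁²} · G_{η₂²}G_{η̄₂²} · G_{η₁²η₂²}G_{η₁²η̄₂²}G_{η̄₁²η₂²}G_{η̄₁²η̄₂²}`, i.e.
`(1 − X)⁻¹(1 + X)⁻² · L_p(Sym² f₁ × Sym² f₂)` in the variable `X = p^{−s}`. [folklore] -/
def pairGoodQ (η₁ η₂ : ℂ) : PowerSeries ℂ :=
  geomSeries 1 * geomSeries 1 * (geomSeries (-1) * geomSeries (-1)) *
    (geomSeries (η₁ ^ 2) * geomSeries (conj η₁ ^ 2)) *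
    (geomSeries (η₂ ^ 2) * geomSeries (conj η₂ ^ 2)) *
    (geomSeries (η₁ ^ 2 * η₂ ^ 2) * geomSeries (η₁ ^ 2 * conj η₂ ^ 2) *
      (geomSeries (conj η₁ ^ 2 * η₂ ^ 2) * geomSeries (conj η₁ ^ 2 * conj η₂ ^ 2)))

/-- The sixteen-letter local factor as an explicit product. [folklore] -/
theorem satakeSeries_pairLetters (η₁ η₂ : ℂ) :
    satakeSeries (pairLetters η₁ η₂) =
      (geomSeries 1 * geomSeries (η₂ ^ 2) * geomSeries 1 * geomSeries (conj η₂ ^ 2)) *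
      (geomSeries (η₁ ^ 2) * geomSeries (η₁ ^ 2 * η₂ ^ 2) * geomSeries (η₁ ^ 2) *
        geomSeries (η₁ ^ 2 * conj η₂ ^ 2)) *
      (geomSeries 1 * geomSeries (η₂ ^ 2) * geomSeries 1 * geomSeries (conj η₂ ^ 2)) *
      (geomSeries (conj η₁ ^ 2) * geomSeries (conj η₁ ^ 2 * η₂ ^ 2) * geomSeries (conj η₁ ^ 2) *
        geomSeries (conj η₁ ^ 2 * conj η₂ ^ 2)) := by
  rw [satakeSeries_prod_index]
  simp only [satakeSeries, pairLetters, Fin.prod_univ_four, symmSqLetters, one_mul, mul_one]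

/-- **The local identity at a good prime**:
`S̃₁ · S̃₂ · Q_p = ∏_{16 letters} (1 − v X)⁻¹` with `S̃ᵢ = (1 + X) G_1 G_{ηᵢ²} G_{η̄ᵢ²}`. [folklore] -/
theorem normSqLocal_mul_pairGoodQ_eq (η₁ η₂ : ℂ) :
    ((1 + X) * (geomSeries 1 * (geomSeries (η₁ ^ 2) * geomSeries (conj η₁ ^ 2)))) *
      ((1 + X) * (geomSeries 1 * (geomSeries (η₂ ^ 2) * geomSeries (conj η₂ ^ 2)))) *
        pairGoodQ η₁ η₂ = satakeSeries (pairLetters η₁ η₂) := by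
  rw [satakeSeries_pairLetters]
  have h := one_add_X_mul_geomSeries_neg_one
  have key : ((1 + X) * (geomSeries 1 * (geomSeries (η₁ ^ 2) * geomSeries (conj η₁ ^ 2)))) *
      ((1 + X) * (geomSeries 1 * (geomSeries (η₂ ^ 2) * geomSeries (conj η₂ ^ 2)))) *
        pairGoodQ η₁ η₂ =
      (((1 : PowerSeries ℂ) + X) * geomSeries (-1)) ^ 2 *
      ((geomSeries 1 * geomSeries (η₂ ^ 2) * geomSeries 1 * geomSeries (conj η₂ ^ 2)) *
      (geomSeries (η₁ ^ 2) * geomSeries (η₁ ^ 2 * η₂ ^ 2) * geomSeries (η₁ ^ 2) *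
        geomSeries (η₁ ^ 2 * conj η₂ ^ 2)) *
      (geomSeries 1 * geomSeries (η₂ ^ 2) * geomSeries 1 * geomSeries (conj η₂ ^ 2)) *
      (geomSeries (conj η₁ ^ 2) * geomSeries (conj η₁ ^ 2 * η₂ ^ 2) * geomSeries (conj η₁ ^ 2) *
        geomSeries (conj η₁ ^ 2 * conj η₂ ^ 2))) := by
    unfold pairGoodQ; ring
  rw [key, h, one_pow, one_mul]

/-- The power sums of the four letters: `1 + η^{2r} + 1 + η̄^{2r} = |1 + η^{2r}|²` for `|η| = 1`. [folklore] -/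
theorem sum_symmSqLetters_pow {η : ℂ} (hη : η * conj η = 1) (r : ℕ) :
    ∑ a, symmSqLetters η a ^ r = (1 + η ^ (2 * r)) * conj (1 + η ^ (2 * r)) := by
  rw [Fin.sum_univ_four]
  simp only [symmSqLetters, one_pow, map_add, map_one, map_pow]
  have h2 : η ^ (2 * r) * conj η ^ (2 * r) = 1 := by rw [← mul_pow, hη, one_pow]
  rw [← pow_mul, ← pow_mul]
  linear_combination -h2

/-- **Non-negativity of the sixteen-letter local factor**: its power sums are
`|1 + η₁^{2r}|² · |1 + η₂^{2r}|² ≥ 0`. [folklore] -/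
theorem coeff_satakeSeries_pairLetters_nonneg {η₁ η₂ : ℂ} (h₁ : η₁ * conj η₁ = 1)
    (h₂ : η₂ * conj η₂ = 1) (n : ℕ) : 0 ≤ coeff n (satakeSeries (pairLetters η₁ η₂)) := by
  refine coeff_satakeSeries_nonneg_of_powerSum_nonneg _ (fun r _ ↦ ?_) n
  have : powerSum (pairLetters η₁ η₂) r =
      (∑ a, symmSqLetters η₁ a ^ r) * (∑ b, symmSqLetters η₂ b ^ r) := by
    rw [powerSum, Finset.sum_mul_sum, ← Finset.univ_product_univ, Finset.sum_product]
    refine Finset.sum_congr rfl fun a _ ↦ Finset.sum_congr rfl fun b _ ↦ ?_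
    rw [pairLetters, mul_pow]
  rw [this, sum_symmSqLetters_pow h₁, sum_symmSqLetters_pow h₂, Complex.mul_conj, Complex.mul_conj]
  exact mul_nonneg (Complex.zero_le_real.mpr (Complex.normSq_nonneg _))
    (Complex.zero_le_real.mpr (Complex.normSq_nonneg _))

/-- Coefficient bound for the sixteen-letter factor with unitary letters: `≤ C(n+16, 16)`. [folklore] -/
theorem norm_coeff_satakeSeries_pairLetters_le {η₁ η₂ : ℂ} (h₁ : ‖η₁‖ = 1) (h₂ : ‖η₂‖ = 1) (n : ℕ) :
    ‖coeff n (satakeSeries (pairLetters η₁ η₂))‖ ≤ ((n + 16).choose 16 : ℝ) := by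
  have := norm_coeff_prod_geomSeries_le (Finset.univ : Finset (Fin 4 × Fin 4)) (pairLetters η₁ η₂)
    (fun x _ ↦ ?_) n
  · simpa [satakeSeries] using this
  · have hl : ∀ (η : ℂ), ‖η‖ = 1 → ∀ a, ‖symmSqLetters η a‖ ≤ 1 := by
      intro η hη a
      match a with
      | 0 => simp [symmSqLetters]
      | 1 => simp [symmSqLetters, hη]
      | 2 => simp [symmSqLetters]
      | 3 => simp [symmSqLetters, hη]
    rw [pairLetters, norm_mul]
    exact mul_le_one₀ (hl η₁ h₁ x.1) (norm_nonneg _) (hl η₂ h₂ x.2)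

/-- Coefficient bound for `Q_p` at a good prime with unitary letters: `≤ C(n+12, 12)`. [folklore] -/
theorem norm_coeff_pairGoodQ_le {η₁ η₂ : ℂ} (h₁ : ‖η₁‖ = 1) (h₂ : ‖η₂‖ = 1) (n : ℕ) :
    ‖coeff n (pairGoodQ η₁ η₂)‖ ≤ ((n + 12).choose 12 : ℝ) := by
  -- the twelve parameters, as a family on `Fin 12`
  let u : Fin 12 → ℂ := ![1, 1, -1, -1, η₁ ^ 2, conj η₁ ^ 2, η₂ ^ 2, conj η₂ ^ 2,
    η₁ ^ 2 * η₂ ^ 2, η₁ ^ 2 * conj η₂ ^ 2, conj η₁ ^ 2 * η₂ ^ 2, conj η₁ ^ 2 * conj η₂ ^ 2]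
  have hQ : pairGoodQ η₁ η₂ = ∏ j ∈ (Finset.univ : Finset (Fin 12)), geomSeries (u j) := by
    rw [Finset.prod_fin_eq_prod_range]
    simp only [Finset.prod_range_succ, Finset.prod_range_zero, one_mul, dite_true,
      show (0 : ℕ) < 12 from by norm_num, show (1 : ℕ) < 12 from by norm_num]
    simp [u, pairGoodQ]
    ring
  have hη : ∀ j, ‖u j‖ ≤ 1 := by
    have e1 : ‖η₁ ^ 2‖ = 1 := by rw [norm_pow, h₁, one_pow]
    have e2 : ‖η₂ ^ 2‖ = 1 := by rw [norm_pow, h₂, one_pow]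
    have e3 : ‖conj η₁ ^ 2‖ = 1 := by rw [norm_pow, Complex.norm_conj, h₁, one_pow]
    have e4 : ‖conj η₂ ^ 2‖ = 1 := by rw [norm_pow, Complex.norm_conj, h₂, one_pow]
    intro j
    fin_cases j <;> simp [u, e1, e2, e3, e4]
  rw [hQ]
  simpa using norm_coeff_prod_geomSeries_le Finset.univ u (fun j _ ↦ hη j) n


/-! ## Framework: multiplicative functions from local data -/

namespace PairSeries

/-! ### Multiplicative functions `ℕ → ℂ` -/

/-- `f 1 = 1` and `f (m n) = f m f n` for coprime `m, n`. [folklore] -/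
def IsMult (f : ℕ → ℂ) : Prop :=
  f 1 = 1 ∧ ∀ {m n : ℕ}, m.Coprime n → f (m * n) = f m * f n

/-- `toArithmeticFunction f n = f n` off `0`. [folklore] -/
private theorem toAF_apply (f : ℕ → ℂ) (n : ℕ) :
    toArithmeticFunction f n = if n = 0 then 0 else f n := rfl

/-- `toArithmeticFunction f n = f n` for `n ≠ 0`. [folklore] -/
private theorem toAF_apply_of_ne_zero {f : ℕ → ℂ} {n : ℕ} (hn : n ≠ 0) :
    toArithmeticFunction f n = f n := by
  rw [toAF_apply, if_neg hn]

/-- A multiplicative function defines a multiplicative arithmetic function. [folklore] -/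
theorem IsMult.isMultiplicative_toAF {f : ℕ → ℂ} (hf : IsMult f) :
    (toArithmeticFunction f).IsMultiplicative := by
  refine ⟨by rw [toAF_apply_of_ne_zero one_ne_zero, hf.1], fun {m n} hmn ↦ ?_⟩
  by_cases hm : m = 0
  · subst hm; simp [toAF_apply]
  by_cases hn : n = 0
  · subst hn; simp [toAF_apply]
  rw [toAF_apply_of_ne_zero (mul_ne_zero hm hn), toAF_apply_of_ne_zero hm,
    toAF_apply_of_ne_zero hn, hf.2 hmn]

/-- The Dirichlet convolution is the product of the associated arithmetic functions (its definition). [folklore] -/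
theorem convolution_eq_coe_mul (f g : ℕ → ℂ) :
    f ⍟ g = ⇑(toArithmeticFunction f * toArithmeticFunction g) := rfl

/-- The convolution of multiplicative functions is multiplicative. [folklore] -/
theorem IsMult.convolution {f g : ℕ → ℂ} (hf : IsMult f) (hg : IsMult g) : IsMult (f ⍟ g) := by
  have hm := hf.isMultiplicative_toAF.mul hg.isMultiplicative_toAF
  refine ⟨?_, fun {m n} hmn ↦ ?_⟩
  · rw [convolution_eq_coe_mul]
    exact hm.1
  · rw [convolution_eq_coe_mul]
    exact hm.2 hmn

/-- Two multiplicative functions with the same value at `0` agreeing on prime powers are equal. [folklore] -/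
theorem IsMult.eq_of_prime_pow {f g : ℕ → ℂ} (hf : IsMult f) (hg : IsMult g) (h0 : f 0 = g 0)
    (h : ∀ p e : ℕ, p.Prime → f (p ^ e) = g (p ^ e)) : f = g := by
  have key : toArithmeticFunction f = toArithmeticFunction g := by
    rw [ArithmeticFunction.IsMultiplicative.eq_iff_eq_on_prime_powers _ hf.isMultiplicative_toAF _
      hg.isMultiplicative_toAF]
    intro p e hp
    rw [toAF_apply_of_ne_zero (pow_ne_zero _ hp.ne_zero),
      toAF_apply_of_ne_zero (pow_ne_zero _ hp.ne_zero), h p e hp]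
  funext n
  rcases eq_or_ne n 0 with rfl | hn
  · exact h0
  · have := congrArg (fun F : ArithmeticFunction ℂ ↦ F n) key
    simpa [toAF_apply_of_ne_zero hn] using this

/-- A multiplicative function is the product of its values on the prime powers exactly dividing `n`. [folklore] -/
theorem IsMult.eq_prod_primeFactors {f : ℕ → ℂ} (hf : IsMult f) {n : ℕ} (hn : n ≠ 0) :
    f n = ∏ p ∈ n.primeFactors, f (p ^ n.factorization p) := by
  have := hf.isMultiplicative_toAF.multiplicative_factorization (toArithmeticFunction f) hn
  rw [toAF_apply_of_ne_zero hn] at this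
  rw [this]
  refine Finset.prod_congr rfl fun p hp ↦ ?_
  exact toAF_apply_of_ne_zero (pow_ne_zero _ (Nat.prime_of_mem_primeFactors hp).ne_zero)

/-- A multiplicative function which is non-negative on prime powers is non-negative (for the order
of `ℂ`: real and `≥ 0`), provided `0 ≤ f 0`. [folklore] -/
theorem IsMult.nonneg_of_prime_pow {f : ℕ → ℂ} (hf : IsMult f) (h0 : 0 ≤ f 0)
    (h : ∀ p e : ℕ, p.Prime → 0 ≤ f (p ^ e)) : 0 ≤ f := by
  intro n
  rcases eq_or_ne n 0 with rfl | hn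
  · exact h0
  rw [hf.eq_prod_primeFactors hn]
  exact Finset.prod_nonneg fun p hp ↦ h p _ (Nat.prime_of_mem_primeFactors hp)

/-! ### Convolution on prime powers and local power series -/

/-- The local power series of `f` at `p`: `∑_e f(p^e) X^e`. [folklore] -/
def locPS (f : ℕ → ℂ) (p : ℕ) : PowerSeries ℂ := PowerSeries.mk fun e ↦ f (p ^ e)

/-- The coefficients of the local series. [folklore] -/
@[simp] theorem coeff_locPS (f : ℕ → ℂ) (p e : ℕ) : coeff e (locPS f p) = f (p ^ e) := by
  simp [locPS]

/-- `(f ⍟ g)(p^k) = ∑_{e ≤ k} f(p^e) g(p^{k-e})`. [folklore] -/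
theorem convolution_prime_pow (f g : ℕ → ℂ) {p : ℕ} (hp : p.Prime) (k : ℕ) :
    (f ⍟ g) (p ^ k) = ∑ e ∈ range (k + 1), f (p ^ e) * g (p ^ (k - e)) := by
  rw [LSeries.convolution_def]
  dsimp only
  rw [Nat.sum_divisorsAntidiagonal (fun a b ↦ f a * g b), Nat.sum_divisors_prime_pow hp]
  refine Finset.sum_congr rfl fun e he ↦ ?_
  rw [Nat.pow_div (Nat.lt_succ_iff.mp (Finset.mem_range.mp he)) hp.pos]

/-- The local series of a convolution is the product of the local series. [folklore] -/
theorem locPS_convolution (f g : ℕ → ℂ) {p : ℕ} (hp : p.Prime) :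
    locPS (f ⍟ g) p = locPS f p * locPS g p := by
  ext k
  rw [coeff_locPS, convolution_prime_pow f g hp, coeff_mul,
    Finset.Nat.sum_antidiagonal_eq_sum_range_succ_mk]
  simp [coeff_locPS]

/-! ### Multiplicative functions from local data -/

/-- The multiplicative function with prescribed values `c p e` at the prime powers `p^e`. [folklore] -/
def ofLocal (c : ℕ → ℕ → ℂ) (n : ℕ) : ℂ :=
  if n = 0 then 0 else ∏ p ∈ n.primeFactors, c p (n.factorization p)

/-- `ofLocal c 0 = 0`. [folklore] -/
theorem ofLocal_zero (c : ℕ → ℕ → ℂ) : ofLocal c 0 = 0 := by simp [ofLocal]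

/-- `ofLocal c 1 = 1`. [folklore] -/
theorem ofLocal_one (c : ℕ → ℕ → ℂ) : ofLocal c 1 = 1 := by simp [ofLocal]

/-- `ofLocal c (p^e) = c p e` (when `c p 0 = 1`). [folklore] -/
theorem ofLocal_prime_pow (c : ℕ → ℕ → ℂ) {p : ℕ} (hp : p.Prime) (hc : c p 0 = 1) (e : ℕ) :
    ofLocal c (p ^ e) = c p e := by
  rcases Nat.eq_zero_or_pos e with rfl | he
  · simp [ofLocal, hc]
  · simp [ofLocal, hp.ne_zero, Nat.primeFactors_prime_pow he.ne' hp, hp.factorization_self]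

/-- `ofLocal c` is multiplicative on coprime arguments. [folklore] -/
theorem ofLocal_mul_of_coprime (c : ℕ → ℕ → ℂ) {m n : ℕ} (hmn : m.Coprime n) :
    ofLocal c (m * n) = ofLocal c m * ofLocal c n := by
  rcases eq_or_ne m 0 with rfl | hm
  · simp [ofLocal]
  rcases eq_or_ne n 0 with rfl | hn
  · simp [ofLocal]
  simp only [ofLocal, mul_ne_zero hm hn, hm, hn, if_false]
  rw [hmn.primeFactors_mul, Finset.prod_union hmn.disjoint_primeFactors]
  congr 1
  · refine Finset.prod_congr rfl fun p hp ↦ ?_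
    have hpm : p ∣ m := Nat.dvd_of_mem_primeFactors hp
    have hp' := Nat.prime_of_mem_primeFactors hp
    have hpn : ¬ p ∣ n := hp'.coprime_iff_not_dvd.mp (Nat.Coprime.coprime_dvd_left hpm hmn)
    rw [Nat.factorization_mul_apply_of_coprime hmn, Nat.factorization_eq_zero_of_not_dvd hpn,
      add_zero]
  · refine Finset.prod_congr rfl fun p hp ↦ ?_
    have hpn : p ∣ n := Nat.dvd_of_mem_primeFactors hp
    have hp' := Nat.prime_of_mem_primeFactors hp
    have hpm : ¬ p ∣ m := hp'.coprime_iff_not_dvd.mp (Nat.Coprime.coprime_dvd_left hpn hmn.symm)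
    rw [Nat.factorization_mul_apply_of_coprime hmn, Nat.factorization_eq_zero_of_not_dvd hpm,
      zero_add]

/-- `ofLocal c` is multiplicative. [folklore] -/
theorem isMult_ofLocal (c : ℕ → ℕ → ℂ) : IsMult (ofLocal c) :=
  ⟨ofLocal_one c, fun hmn ↦ ofLocal_mul_of_coprime c hmn⟩

/-- The local series of `ofLocal c` at `p` is `∑_e c p e X^e`. [folklore] -/
theorem locPS_ofLocal (c : ℕ → ℕ → ℂ) {p : ℕ} (hp : p.Prime) (hc : c p 0 = 1) :
    locPS (ofLocal c) p = PowerSeries.mk (c p) := by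
  ext e
  rw [coeff_locPS, ofLocal_prime_pow c hp hc, coeff_mk]


/-! ### Summability: the divisor-power majorant -/

/-- Summability transfer along a pointwise norm bound. [folklore] -/
theorem LSeriesSummable_of_norm_le {f g : ℕ → ℂ} (h : ∀ n, ‖f n‖ ≤ ‖g n‖) {s : ℂ}
    (hg : LSeriesSummable g s) : LSeriesSummable f s :=
  hg.norm.of_norm_bounded fun _ ↦ norm_term_le s (h _)

/-- The `m`-fold divisor function `d_m = 1 ⍟ ⋯ ⍟ 1` (`m` factors; `d_0 = δ`). [folklore] -/
def divPow : ℕ → ℕ → ℂ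
  | 0 => fun n ↦ if n = 1 then 1 else 0
  | m + 1 => divPow m ⍟ fun _ ↦ 1

/-- The convolution unit `δ` is multiplicative. [folklore] -/
theorem isMult_delta : IsMult (fun n : ℕ ↦ if n = 1 then (1 : ℂ) else 0) := by
  refine ⟨if_pos rfl, fun {m n} hmn ↦ ?_⟩
  dsimp only
  by_cases h : m * n = 1
  · rw [if_pos h, if_pos (Nat.eq_one_of_mul_eq_one_right h), if_pos (Nat.eq_one_of_mul_eq_one_left h),
      mul_one]
  · rw [if_neg h]
    rcases ne_or_eq m 1 with hm | rfl
    · rw [if_neg hm, zero_mul]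
    · rw [one_mul] at h; rw [if_neg h, mul_zero]

/-- The constant function `1` is multiplicative. [folklore] -/
theorem isMult_one : IsMult (fun _ : ℕ ↦ (1 : ℂ)) := ⟨rfl, fun _ ↦ (mul_one _).symm⟩

/-- `d_m` is multiplicative. [folklore] -/
theorem isMult_divPow (m : ℕ) : IsMult (divPow m) := by
  induction m with
  | zero => exact isMult_delta
  | succ m ih => exact ih.convolution isMult_one

/-- `d_m(0) = 0`. [folklore] -/
theorem divPow_zero_apply (m : ℕ) : divPow m 0 = 0 := by
  cases m with
  | zero => simp [divPow]
  | succ m => simp [divPow]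

/-- `d_{m+1}(p^e) = C(e+m, m)`. [folklore] -/
theorem divPow_succ_prime_pow (m : ℕ) {p : ℕ} (hp : p.Prime) (e : ℕ) :
    divPow (m + 1) (p ^ e) = ((e + m).choose m : ℂ) := by
  induction m generalizing e with
  | zero =>
    simp only [divPow, convolution_prime_pow _ _ hp, mul_one, add_zero, Nat.choose_zero_right,
      Nat.cast_one]
    rw [Finset.sum_eq_single 0]
    · simp
    · intro b _ hb
      rw [if_neg]
      exact fun h ↦ hb ((Nat.pow_eq_one.mp h).resolve_left hp.one_lt.ne')
    · simp
  | succ m ih =>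
    rw [divPow, convolution_prime_pow _ _ hp]
    simp only [mul_one, ih]
    rw [show m + 1 = m.succ from rfl]
    exact_mod_cast Nat.sum_range_add_choose e m

/-- `L(d_m, s)` converges absolutely for `Re s > 1`. [folklore] -/
theorem LSeriesSummable_divPow (m : ℕ) {s : ℂ} (hs : 1 < s.re) : LSeriesSummable (divPow m) s := by
  induction m with
  | zero =>
    refine LSeriesSummable_of_le_const_mul_rpow (x := 1) hs ⟨1, fun n _ ↦ ?_⟩
    simp only [divPow, sub_self, Real.rpow_zero, mul_one]
    split_ifs <;> simp
  | succ m ih => exact ih.convolution (LSeriesSummable_one_iff.mpr hs)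

/-- **Summability from prime-power bounds of divisor type**: if `f` is multiplicative and
`‖f(p^e)‖ ≤ C(e+m, m)` for all primes `p` and `e ≥ 0`, then `L(f, s)` converges absolutely for
`Re s > 1` (comparison with `d_{m+1}`). [folklore] -/
theorem IsMult.LSeriesSummable_of_prime_pow_le {f : ℕ → ℂ} (hf : IsMult f) (h0 : f 0 = 0) (m : ℕ)
    (h : ∀ p e : ℕ, p.Prime → ‖f (p ^ e)‖ ≤ (e + m).choose m) {s : ℂ} (hs : 1 < s.re) :
    LSeriesSummable f s := by
  refine LSeriesSummable_of_norm_le (g := divPow (m + 1)) (fun n ↦ ?_) (LSeriesSummable_divPow _ hs)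
  rcases eq_or_ne n 0 with rfl | hn
  · simp [h0, divPow_zero_apply]
  rw [hf.eq_prod_primeFactors hn, (isMult_divPow (m + 1)).eq_prod_primeFactors hn, norm_prod,
    norm_prod]
  refine Finset.prod_le_prod (fun _ _ ↦ norm_nonneg _) fun p hp ↦ ?_
  have hp' := Nat.prime_of_mem_primeFactors hp
  rw [divPow_succ_prime_pow m hp', Complex.norm_natCast]
  exact h p _ hp'


/-- Convolution preserves non-negativity. [folklore] -/
theorem convolution_nonneg {f g : ℕ → ℂ} (hf : 0 ≤ f) (hg : 0 ≤ g) : 0 ≤ f ⍟ g := by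
  intro n
  rw [LSeries.convolution_def]
  exact Finset.sum_nonneg fun x _ ↦ mul_nonneg (hf _) (hg _)

/-- `(f ⍟ g)(1) = f(1) g(1)`. [folklore] -/
theorem convolution_apply_one (f g : ℕ → ℂ) : (f ⍟ g) 1 = f 1 * g 1 := by
  have := convolution_prime_pow f g Nat.prime_two 0
  simpa using this

end PairSeries

open PairSeries

/-! ## The pair series of two elliptic newforms -/

section Pair

variable {N₁ N₂ : ℕ} [NeZero N₁] [NeZero N₂]

/-- The unitary letter of `f` at `p`: `η_p(f) = unitLetter (Re a_p) p`. [folklore] -/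
def letterOf {N : ℕ} (f : CuspForm (Gamma0 N) 2) (p : ℕ) : ℂ := unitLetter (cuspCoeff f p).re p

/-- **The local series `Q_p` of the pair**: `pairGoodQ` at the primes `p ∤ N₁N₂`, and `1` at `p ∣ N₁N₂`. [folklore] -/
def pairLocalQ (f₁ : CuspForm (Gamma0 N₁) 2) (f₂ : CuspForm (Gamma0 N₂) 2) (p : ℕ) : PowerSeries ℂ :=
  if p ∣ N₁ * N₂ then 1 else pairGoodQ (letterOf f₁ p) (letterOf f₂ p)

/-- **The coefficients `q(n)`** of the pair series: the multiplicative function with local series `Q_p`. [folklore] -/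
def symmSqPairCoeff (f₁ : CuspForm (Gamma0 N₁) 2) (f₂ : CuspForm (Gamma0 N₂) 2) : ℕ → ℂ :=
  ofLocal fun p e ↦ coeff e (pairLocalQ f₁ f₂ p)

/-- **The pair function** `P(s) = ζ(s) · L(q, s)` (`= ζ(2s)² ∏_{p ∣ N₁N₂}(1 − p^{−s})(1 + p^{−s})² ·
L^{(N₁N₂)}(s, Sym² f₁ × Sym² f₂)` for `Re s > 1`). [folklore] -/
def symmSqPairL (f₁ : CuspForm (Gamma0 N₁) 2) (f₂ : CuspForm (Gamma0 N₂) 2) (s : ℂ) : ℂ :=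
  riemannZeta s * LSeries (symmSqPairCoeff f₁ f₂) s

variable (f₁ : CuspForm (Gamma0 N₁) 2) (f₂ : CuspForm (Gamma0 N₂) 2)

/-- The constant coefficient of `Q_p` at a good prime is `1`. [folklore] -/
theorem coeff_zero_pairGoodQ (η₁ η₂ : ℂ) : coeff 0 (pairGoodQ η₁ η₂) = 1 := by
  simp [pairGoodQ, coeff_zero_eq_constantCoeff_apply]

omit [NeZero N₁] [NeZero N₂] in
/-- The constant coefficient of `Q_p` is `1`. [folklore] -/
theorem coeff_zero_pairLocalQ (p : ℕ) : coeff 0 (pairLocalQ f₁ f₂ p) = 1 := by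
  unfold pairLocalQ
  split_ifs
  · simp
  · exact coeff_zero_pairGoodQ _ _

omit [NeZero N₁] [NeZero N₂] in
/-- `q` is multiplicative. [folklore] -/
theorem isMult_symmSqPairCoeff : IsMult (symmSqPairCoeff f₁ f₂) := isMult_ofLocal _

omit [NeZero N₁] [NeZero N₂] in
/-- `q(0) = 0`. [folklore] -/
theorem symmSqPairCoeff_zero : symmSqPairCoeff f₁ f₂ 0 = 0 := ofLocal_zero _

omit [NeZero N₁] [NeZero N₂] in
/-- `q(p^e)` is the `e`-th coefficient of `Q_p`. [folklore] -/
theorem symmSqPairCoeff_prime_pow {p : ℕ} (hp : p.Prime) (e : ℕ) :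
    symmSqPairCoeff f₁ f₂ (p ^ e) = coeff e (pairLocalQ f₁ f₂ p) :=
  ofLocal_prime_pow _ hp (coeff_zero_pairLocalQ f₁ f₂ p) e

omit [NeZero N₁] [NeZero N₂] in
/-- The local series of `q` at `p` is `Q_p`. [folklore] -/
theorem locPS_symmSqPairCoeff {p : ℕ} (hp : p.Prime) :
    locPS (symmSqPairCoeff f₁ f₂) p = pairLocalQ f₁ f₂ p := by
  rw [symmSqPairCoeff, locPS_ofLocal _ hp (coeff_zero_pairLocalQ f₁ f₂ p)]
  ext e; simp

variable {f₁ f₂}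

/-- Hasse's bound `a_p² ≤ 4p` for the newform of an elliptic curve (every prime `p`). [cite: SilvermanAEC2009, Thm. V.1.1] -/
theorem IsNewformOf.re_cuspCoeff_sq_le {N : ℕ} [NeZero N] {W : WeierstrassCurve ℚ} [W.IsElliptic]
    {f : CuspForm (Gamma0 N) 2} (hf : IsNewformOf W f) {p : ℕ} (hp : p.Prime) :
    (cuspCoeff f p).re ^ 2 ≤ 4 * p := by
  have h := hf.norm_cuspCoeff_prime_pow_sq_le hp 1
  rw [pow_one, pow_one, hf.1.norm_cuspCoeff_sq] at h
  norm_num at h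
  linarith

/-- The letter `η_p(f)` is unitary. [folklore] -/
theorem IsNewformOf.norm_letterOf {N : ℕ} [NeZero N] {W : WeierstrassCurve ℚ} [W.IsElliptic]
    {f : CuspForm (Gamma0 N) 2} (hf : IsNewformOf W f) {p : ℕ} (hp : p.Prime) : ‖letterOf f p‖ = 1 :=
  norm_unitLetter hp.pos (hf.re_cuspCoeff_sq_le hp)

/-- `η_p(f) η̄_p(f) = 1`. [folklore] -/
theorem IsNewformOf.letterOf_mul_conj {N : ℕ} [NeZero N] {W : WeierstrassCurve ℚ} [W.IsElliptic]
    {f : CuspForm (Gamma0 N) 2} (hf : IsNewformOf W f) {p : ℕ} (hp : p.Prime) :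
    letterOf f p * conj (letterOf f p) = 1 :=
  unitLetter_mul_conj hp.pos (hf.re_cuspCoeff_sq_le hp)

/-- **Coefficient bound** `‖q(p^e)‖ ≤ C(e+12, 12)`. [folklore] -/
theorem norm_symmSqPairCoeff_prime_pow_le {W₁ W₂ : WeierstrassCurve ℚ} [W₁.IsElliptic] [W₂.IsElliptic]
    (hf₁ : IsNewformOf W₁ f₁) (hf₂ : IsNewformOf W₂ f₂) {p : ℕ} (hp : p.Prime) (e : ℕ) :
    ‖symmSqPairCoeff f₁ f₂ (p ^ e)‖ ≤ ((e + 12).choose 12 : ℝ) := by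
  rw [symmSqPairCoeff_prime_pow f₁ f₂ hp, pairLocalQ]
  split_ifs with h
  · rw [coeff_one]
    split_ifs with he
    · subst he; simp
    · simp
  · exact norm_coeff_pairGoodQ_le (hf₁.norm_letterOf hp) (hf₂.norm_letterOf hp) e

/-- **`L(q, s)` converges absolutely for `Re s > 1`.** [folklore] -/
theorem LSeriesSummable_symmSqPairCoeff {W₁ W₂ : WeierstrassCurve ℚ} [W₁.IsElliptic] [W₂.IsElliptic]
    (hf₁ : IsNewformOf W₁ f₁) (hf₂ : IsNewformOf W₂ f₂) {s : ℂ} (hs : 1 < s.re) :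
    LSeriesSummable (symmSqPairCoeff f₁ f₂) s :=
  (isMult_symmSqPairCoeff f₁ f₂).LSeriesSummable_of_prime_pow_le (symmSqPairCoeff_zero f₁ f₂) 12
    (fun _ e hp ↦ norm_symmSqPairCoeff_prime_pow_le hf₁ hf₂ hp e) hs

/-! ### `n ↦ ‖a_n‖²/n` is multiplicative -/

/-- For a newform, `n ↦ ‖a_n‖²/n` is multiplicative (`a₁ = 1`, `a_{mn} = a_m a_n` for coprime `m, n`,
real coefficients). [cite: AtkinLehner1970, Thm. 3] -/
theorem IsNewform0.isMult_normSqCoeffDiv {N : ℕ} [NeZero N] {f : CuspForm (Gamma0 N) 2}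
    (hf : IsNewform0 f) : IsMult (normSqCoeffDiv f) := by
  refine ⟨?_, fun {m n} hmn ↦ ?_⟩
  · simp [normSqCoeffDiv, show cuspCoeff f 1 = 1 from hf.2.2]
  · simp only [normSqCoeffDiv, hf.norm_cuspCoeff_sq, hf.re_cuspCoeff_mul_of_coprime hmn]
    push_cast
    ring

omit [NeZero N₁] in
/-- `‖a_n‖²/n ≥ 0`. [folklore] -/
theorem normSqCoeffDiv_nonneg' (f : CuspForm (Gamma0 N₁) 2) : 0 ≤ normSqCoeffDiv f := fun n ↦ by
  simp only [normSqCoeffDiv]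
  exact Complex.zero_le_real.mpr (by positivity)

omit [NeZero N₁] in
/-- The local series of `n ↦ ‖a_n‖²/n` at `p` is `S̃_f(p)` (by definition). [folklore] -/
theorem locPS_normSqCoeffDiv (f : CuspForm (Gamma0 N₁) 2) (p : ℕ) :
    locPS (normSqCoeffDiv f) p = normSqLocal f p := rfl

omit [NeZero N₁] in
/-- The coefficients of `S̃_f(p)` are `≥ 0`. [folklore] -/
theorem coeff_normSqLocal_nonneg (f : CuspForm (Gamma0 N₁) 2) (p e : ℕ) : 0 ≤ coeff e (normSqLocal f p) := by
  rw [coeff_normSqLocal]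
  exact Complex.zero_le_real.mpr (by positivity)

/-! ### Local positivity of `S̃₁ S̃₂ Q_p` -/

/-- **The local series `T_p = S̃₁ S̃₂ Q_p` has non-negative coefficients** at every prime `p`:
at `p ∤ N₁N₂` it is the sixteen-letter factor `satakeSeries (pairLetters η₁ η₂)`, at `p ∣ N₁N₂` it is
`S̃₁ S̃₂`, a product of series with non-negative coefficients. [folklore] -/
theorem coeff_localT_nonneg {W₁ W₂ : WeierstrassCurve ℚ} [W₁.IsElliptic] [W₂.IsElliptic]
    (hf₁ : IsNewformOf W₁ f₁) (hf₂ : IsNewformOf W₂ f₂) {p : ℕ} (hp : p.Prime) (n : ℕ) :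
    0 ≤ coeff n (normSqLocal f₁ p * (normSqLocal f₂ p * pairLocalQ f₁ f₂ p)) := by
  unfold pairLocalQ
  split_ifs with h
  · rw [mul_one, coeff_mul]
    exact Finset.sum_nonneg fun x _ ↦
      mul_nonneg (coeff_normSqLocal_nonneg f₁ p _) (coeff_normSqLocal_nonneg f₂ p _)
  · have h₁ : ¬ p ∣ N₁ := fun h' ↦ h (h'.mul_right _)
    have h₂ : ¬ p ∣ N₂ := fun h' ↦ h (h'.mul_left _)
    rw [← mul_assoc, hf₁.normSqLocal_eq_of_not_dvd hp h₁, hf₂.normSqLocal_eq_of_not_dvd hp h₂]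
    change 0 ≤ coeff n ((1 + X) * (geomSeries 1 * (geomSeries (letterOf f₁ p ^ 2) *
      geomSeries (conj (letterOf f₁ p) ^ 2))) * ((1 + X) * (geomSeries 1 *
      (geomSeries (letterOf f₂ p ^ 2) * geomSeries (conj (letterOf f₂ p) ^ 2)))) *
      pairGoodQ (letterOf f₁ p) (letterOf f₂ p))
    rw [normSqLocal_mul_pairGoodQ_eq]
    exact coeff_satakeSeries_pairLetters_nonneg (hf₁.letterOf_mul_conj hp) (hf₂.letterOf_mul_conj hp) n

/-! ### The non-negative Dirichlet series `a = r₁ ⍟ r₂ ⍟ q` -/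

/-- The multiplicative core `b = (‖a‖²/n)_{f₁} ⍟ (‖a‖²/n)_{f₂} ⍟ q` is non-negative. [folklore] -/
theorem pairCore_nonneg {W₁ W₂ : WeierstrassCurve ℚ} [W₁.IsElliptic] [W₂.IsElliptic]
    (hf₁ : IsNewformOf W₁ f₁) (hf₂ : IsNewformOf W₂ f₂) :
    0 ≤ normSqCoeffDiv f₁ ⍟ (normSqCoeffDiv f₂ ⍟ symmSqPairCoeff f₁ f₂) := by
  have hm : IsMult (normSqCoeffDiv f₁ ⍟ (normSqCoeffDiv f₂ ⍟ symmSqPairCoeff f₁ f₂)) :=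
    hf₁.1.isMult_normSqCoeffDiv.convolution (hf₂.1.isMult_normSqCoeffDiv.convolution
      (isMult_symmSqPairCoeff f₁ f₂))
  refine hm.nonneg_of_prime_pow (by simp) fun p e hp ↦ ?_
  have hloc : locPS (normSqCoeffDiv f₁ ⍟ (normSqCoeffDiv f₂ ⍟ symmSqPairCoeff f₁ f₂)) p =
      normSqLocal f₁ p * (normSqLocal f₂ p * pairLocalQ f₁ f₂ p) := by
    rw [locPS_convolution _ _ hp, locPS_convolution _ _ hp, locPS_symmSqPairCoeff f₁ f₂ hp,
      locPS_normSqCoeffDiv, locPS_normSqCoeffDiv]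
  rw [← coeff_locPS (normSqCoeffDiv f₁ ⍟ (normSqCoeffDiv f₂ ⍟ symmSqPairCoeff f₁ f₂)) p e, hloc]
  exact coeff_localT_nonneg hf₁ hf₂ hp e

/-- **The coefficient sequence** `a = r_{f₁} ⍟ r_{f₂} ⍟ q` (`r_f = rankinCoeff f`, the coefficients
of `ζ(s) L_f(s) = ζ(2s) L(|a|², s+1)`). [folklore] -/
def symmSqPairA (f₁ : CuspForm (Gamma0 N₁) 2) (f₂ : CuspForm (Gamma0 N₂) 2) : ℕ → ℂ :=
  rankinCoeff f₁ ⍟ (rankinCoeff f₂ ⍟ symmSqPairCoeff f₁ f₂)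

omit [NeZero N₁] [NeZero N₂] in
/-- `a = 𝟙_□ ⍟ 𝟙_□ ⍟ ((‖a‖²/n)_{f₁} ⍟ (‖a‖²/n)_{f₂} ⍟ q)` (commutativity and associativity of `⍟`). [folklore] -/
theorem symmSqPairA_eq (f₁ : CuspForm (Gamma0 N₁) 2) (f₂ : CuspForm (Gamma0 N₂) 2) :
    symmSqPairA f₁ f₂ = sqInd ⍟ (sqInd ⍟ (normSqCoeffDiv f₁ ⍟ (normSqCoeffDiv f₂ ⍟ symmSqPairCoeff f₁ f₂))) := by
  simp only [symmSqPairA, rankinCoeff, convolution_eq_coe_mul,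
    ArithmeticFunction.toArithmeticFunction_eq_self]
  congr 1
  ring

/-- `𝟙_□ ≥ 0`. [folklore] -/
theorem sqInd_nonneg : 0 ≤ sqInd := fun n ↦ by unfold sqInd; split_ifs <;> simp

/-- **`a ≥ 0`.** [folklore] -/
theorem symmSqPairA_nonneg {W₁ W₂ : WeierstrassCurve ℚ} [W₁.IsElliptic] [W₂.IsElliptic]
    (hf₁ : IsNewformOf W₁ f₁) (hf₂ : IsNewformOf W₂ f₂) : 0 ≤ symmSqPairA f₁ f₂ := by
  rw [symmSqPairA_eq]
  exact convolution_nonneg sqInd_nonneg (convolution_nonneg sqInd_nonneg (pairCore_nonneg hf₁ hf₂))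

/-- **`a(1) = 1`.** [folklore] -/
theorem symmSqPairA_one (hf₁ : IsNewform0 f₁) (hf₂ : IsNewform0 f₂) : symmSqPairA f₁ f₂ 1 = 1 := by
  rw [symmSqPairA, convolution_apply_one, convolution_apply_one, rankinCoeff_one, rankinCoeff_one,
    show cuspCoeff f₁ 1 = 1 from hf₁.2.2, show cuspCoeff f₂ 1 = 1 from hf₂.2.2,
    (isMult_symmSqPairCoeff f₁ f₂).1]
  simp

/-- **Summability of `L(a, s)` for `Re s > 1`.** [folklore] -/
theorem LSeriesSummable_symmSqPairA {W₁ W₂ : WeierstrassCurve ℚ} [W₁.IsElliptic] [W₂.IsElliptic]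
    (hf₁ : IsNewformOf W₁ f₁) (hf₂ : IsNewformOf W₂ f₂) {s : ℂ} (hs : 1 < s.re) :
    LSeriesSummable (symmSqPairA f₁ f₂) s :=
  (LSeriesSummable_rankinCoeff f₁ hs).convolution ((LSeriesSummable_rankinCoeff f₂ hs).convolution
    (LSeriesSummable_symmSqPairCoeff hf₁ hf₂ hs))

/-- **The Dirichlet-series identity** `ζ₁(s) · L_{f₁}(s) L_{f₂}(s) P(s) = (s − 1) · L(a, s)` on `Re s > 1`. [folklore] -/
theorem riemannZeta₁_mul_symmSqL_mul_symmSqPairL {W₁ W₂ : WeierstrassCurve ℚ} [W₁.IsElliptic]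
    [W₂.IsElliptic] (hf₁ : IsNewformOf W₁ f₁) (hf₂ : IsNewformOf W₂ f₂) {s : ℂ} (hs : 1 < s.re) :
    riemannZeta₁ s * (symmSqL N₁ f₁ s * symmSqL N₂ f₂ s * symmSqPairL f₁ f₂ s) =
      (s - 1) * LSeries (symmSqPairA f₁ f₂) s := by
  have hs1 : s ≠ 1 := fun h ↦ by rw [h, Complex.one_re] at hs; exact lt_irrefl _ hs
  have hsub : s - 1 ≠ 0 := sub_ne_zero.mpr hs1
  have h1 := riemannZeta₁_mul_symmSqL_eq_LSeries f₁ hs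
  have h2 := riemannZeta₁_mul_symmSqL_eq_LSeries f₂ hs
  have hζ : riemannZeta s = riemannZeta₁ s / (s - 1) := by
    rw [riemannZeta_eq_inv_sub_mul hs1, inv_mul_eq_div]
  rw [symmSqPairA, LSeries_convolution' (LSeriesSummable_rankinCoeff f₁ hs)
    ((LSeriesSummable_rankinCoeff f₂ hs).convolution (LSeriesSummable_symmSqPairCoeff hf₁ hf₂ hs)),
    LSeries_convolution' (LSeriesSummable_rankinCoeff f₂ hs) (LSeriesSummable_symmSqPairCoeff hf₁ hf₂ hs),
    symmSqPairL, hζ]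
  have : riemannZeta₁ s * (symmSqL N₁ f₁ s * symmSqL N₂ f₂ s *
      (riemannZeta₁ s / (s - 1) * LSeries (symmSqPairCoeff f₁ f₂) s)) =
      (riemannZeta₁ s * symmSqL N₁ f₁ s) * (riemannZeta₁ s * symmSqL N₂ f₂ s) *
        LSeries (symmSqPairCoeff f₁ f₂) s / (s - 1) := by
    field_simp
  rw [this, h1, h2]
  field_simp

/-- **The pair input `coeff₃` of the Siegel scheme, discharged**: for the newforms `f₁, f₂` of two
elliptic curves over `ℚ` there is a non-negative sequence `a` with `a(1) = 1`, `L(a, s)` absolutely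
convergent for `Re s > 1`, and `ζ₁(s) L_{f₁}(s) L_{f₂}(s) P(s) = (s − 1) L(a, s)` there, where
`P = symmSqPairL f₁ f₂`. [folklore] -/
theorem symmSqPairL_coeff₃ {W₁ W₂ : WeierstrassCurve ℚ} [W₁.IsElliptic] [W₂.IsElliptic]
    (hf₁ : IsNewformOf W₁ f₁) (hf₂ : IsNewformOf W₂ f₂) :
    ∃ a : ℕ → ℂ, 0 ≤ a ∧ a 1 = 1 ∧ (∀ s : ℂ, 1 < s.re → LSeriesSummable a s) ∧
      ∀ s : ℂ, 1 < s.re →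
        riemannZeta₁ s * (symmSqL N₁ f₁ s * symmSqL N₂ f₂ s * symmSqPairL f₁ f₂ s) =
          (s - 1) * LSeries a s :=
  ⟨symmSqPairA f₁ f₂, symmSqPairA_nonneg hf₁ hf₂, symmSqPairA_one hf₁.1 hf₂.1,
    fun _ hs ↦ LSeriesSummable_symmSqPairA hf₁ hf₂ hs,
    fun _ hs ↦ riemannZeta₁_mul_symmSqL_mul_symmSqPairL hf₁ hf₂ hs⟩

end Pair

end Literature.NumberTheory.EllipticCurves.ModularForms

end
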